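import Summits.KontsevichZagierPeriods.KontsevichZagierPeriods.Theorems.TerasomaMultiplicationBetaCancellationSideDescentInstances

/-!
# The crux as side reduction at the segment `S_A`

Crux lead seat c8 (`--supports` stmt-KontsevichZagierPeriods-13633, line `dirichlet-companion-to-pi`).
With the master theorem `sideDescent` (`…SideDescent.lean`, p120958) and its instance for the
half-line `(-∞,-1/2)` (`side_ayoubPiCancellation_Iio`, `…SideDescentInstances.lean`), the crux
`BetaCancellation` (≡ item 0540) is EQUIVALENT to **side reduction at `S_A`**: every relation among
disc multiples can be re-certified by moves whose rule-(2) substitutions satisfy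
`Φ x 0 < -1/2 ↔ x 0 < -1/2` (no mass moved into or out of the open half-plane `{x < -1/2}` of the
first disc coordinate). This open stub is weaker than wall reduction (`…WallDescent.lean`,
`sideReduction_of_wallReduction`), which is weaker than fibred reduction (seat c7), all ≡ item 0540:
it is the open core of the crux after seat c8.
-/

noncomputable section

-- `Summit.KontsevichZagierPeriods.KontsevichZagierPeriods.…` is the tree's mandated layout (single-conjunct summit).
set_option linter.dupNamespace false

namespace Summit.KontsevichZagierPeriods.KontsevichZagierPeriods.BetaCancellationLine

open Set
open Literature.NumberTheory.Transcendental
open Literature.NumberTheory.Transcendental.KZ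

/-! ### The crux as side reduction at the segment `S_A` -/

/-- **Monotonicity**: the wall-respecting class (seat c8, `…WallDescent.lean`) is contained in the
class respecting the half-line `(-∞,-1/2)` (the first of the two wall clauses is the side clause).
[folklore] -/
theorem wallClosure_le_sideClosure_Iio :
    AddSubgroup.closure (domainAddRel ∪ integrandAddRel ∪
          {x | ∃ (n : ℕ) (r r' : IntegralRep (n + 1)) (Φ : (Fin (n + 1) → ℝ) → (Fin (n + 1) → ℝ))
              (Φ' : (Fin (n + 1) → ℝ) → (Fin (n + 1) → ℝ) →L[ℝ] (Fin (n + 1) → ℝ)),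
            IsSemialgebraicMapOn ℚ r.domain Φ ∧
            (∀ x ∈ r.domain, HasFDerivWithinAt Φ (Φ' x) r.domain x) ∧ Set.InjOn Φ r.domain ∧
            r'.domain = Φ '' r.domain ∧
            (∀ x ∈ r.domain, r.integrand x = r'.integrand (Φ x) * |(Φ' x).det|) ∧
            (∀ x ∈ r.domain, (Φ x 0 < -1/2 ↔ x 0 < -1/2) ∧ (-1/2 < Φ x 0 ↔ -1/2 < x 0)) ∧
            x = of r - of r'} ∪
          fibredNewtonLeibnizRel) ≤
    AddSubgroup.closure (domainAddRel ∪ integrandAddRel ∪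
          {x | ∃ (n : ℕ) (r r' : IntegralRep (n + 1)) (Φ : (Fin (n + 1) → ℝ) → (Fin (n + 1) → ℝ))
              (Φ' : (Fin (n + 1) → ℝ) → (Fin (n + 1) → ℝ) →L[ℝ] (Fin (n + 1) → ℝ)),
            IsSemialgebraicMapOn ℚ r.domain Φ ∧
            (∀ x ∈ r.domain, HasFDerivWithinAt Φ (Φ' x) r.domain x) ∧ Set.InjOn Φ r.domain ∧
            r'.domain = Φ '' r.domain ∧
            (∀ x ∈ r.domain, r.integrand x = r'.integrand (Φ x) * |(Φ' x).det|) ∧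
            (∀ x ∈ r.domain, Φ x 0 ∈ Set.Iio (-1/2 : ℝ) ↔ x 0 ∈ Set.Iio (-1/2 : ℝ)) ∧
            x = of r - of r'} ∪
          fibredNewtonLeibnizRel) := by
  refine AddSubgroup.closure_mono ?_
  rintro y (((hy | hy) | hy) | hy)
  · exact Or.inl (Or.inl (Or.inl hy))
  · exact Or.inl (Or.inl (Or.inr hy))
  · obtain ⟨k, r, r', Φ, Φ', hΦ, hΦ', hinj, hdom, hf, hwall, rfl⟩ := hy
    exact Or.inl (Or.inr ⟨k, r, r', Φ, Φ', hΦ, hΦ', hinj, hdom, hf,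
      fun x hx => by simpa only [mem_Iio] using (hwall x hx).1, rfl⟩)
  · exact Or.inr hy

/-- **Item 0540 ⟺ SIDE REDUCTION at `S_A`**: `AyoubPiCancellation` holds iff every relation among disc
multiples can be re-certified by moves whose substitutions satisfy `Φ x 0 < -1/2 ↔ x 0 < -1/2`.
[folklore] -/
theorem ayoubPiCancellation_iff_sideReduction_Iio :
    Summit.KontsevichZagierPeriods.KontsevichZagierPeriods.Theses.AyoubSpecialisation.AyoubPiCancellation ↔
    ∀ (P : ∀ n : ℕ, IntegralRep n → IntegralRep (n + 2)),
      (∀ (n : ℕ) (r : IntegralRep n), (P n r).domain = {z : Fin (n + 2) → ℝ | z 0 ^ 2 + z 1 ^ 2 ≤ 1 ∧ (fun i : Fin n => z i.succ.succ) ∈ r.domain} ∧ (P n r).integrand = fun z => r.integrand (fun i : Fin n => z i.succ.succ)) →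
      ∀ c : FormalRep,
        FreeAbelianGroup.lift (fun s : (Σ n, IntegralRep n) => of (P s.1 s.2)) c ∈ relations →
        FreeAbelianGroup.lift (fun s : (Σ n, IntegralRep n) => of (P s.1 s.2)) c ∈
          AddSubgroup.closure (domainAddRel ∪ integrandAddRel ∪
          {x | ∃ (n : ℕ) (r r' : IntegralRep (n + 1)) (Φ : (Fin (n + 1) → ℝ) → (Fin (n + 1) → ℝ))
              (Φ' : (Fin (n + 1) → ℝ) → (Fin (n + 1) → ℝ) →L[ℝ] (Fin (n + 1) → ℝ)),
            IsSemialgebraicMapOn ℚ r.domain Φ ∧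
            (∀ x ∈ r.domain, HasFDerivWithinAt Φ (Φ' x) r.domain x) ∧ Set.InjOn Φ r.domain ∧
            r'.domain = Φ '' r.domain ∧
            (∀ x ∈ r.domain, r.integrand x = r'.integrand (Φ x) * |(Φ' x).det|) ∧
            (∀ x ∈ r.domain, Φ x 0 ∈ Set.Iio (-1/2 : ℝ) ↔ x 0 ∈ Set.Iio (-1/2 : ℝ)) ∧
            x = of r - of r'} ∪
          fibredNewtonLeibnizRel) :=
  ayoubPiCancellation_iff_sideReduction (Set.Iio (-1/2 : ℝ)) wallRestrict_isSemialgebraic_Iio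
    segA_domain_eq_side rfl finish_segA

/-- **`KZ.PiCancellation` ⟺ SIDE REDUCTION at `S_A`** (through `stub_ayoubBridge`). [folklore] -/
theorem piCancellation_iff_sideReduction_Iio :
    Literature.NumberTheory.Transcendental.KZ.PiCancellation ↔
    ∀ (P : ∀ n : ℕ, IntegralRep n → IntegralRep (n + 2)),
      (∀ (n : ℕ) (r : IntegralRep n), (P n r).domain = {z : Fin (n + 2) → ℝ | z 0 ^ 2 + z 1 ^ 2 ≤ 1 ∧ (fun i : Fin n => z i.succ.succ) ∈ r.domain} ∧ (P n r).integrand = fun z => r.integrand (fun i : Fin n => z i.succ.succ)) →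
      ∀ c : FormalRep,
        FreeAbelianGroup.lift (fun s : (Σ n, IntegralRep n) => of (P s.1 s.2)) c ∈ relations →
        FreeAbelianGroup.lift (fun s : (Σ n, IntegralRep n) => of (P s.1 s.2)) c ∈
          AddSubgroup.closure (domainAddRel ∪ integrandAddRel ∪
          {x | ∃ (n : ℕ) (r r' : IntegralRep (n + 1)) (Φ : (Fin (n + 1) → ℝ) → (Fin (n + 1) → ℝ))
              (Φ' : (Fin (n + 1) → ℝ) → (Fin (n + 1) → ℝ) →L[ℝ] (Fin (n + 1) → ℝ)),
            IsSemialgebraicMapOn ℚ r.domain Φ ∧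
            (∀ x ∈ r.domain, HasFDerivWithinAt Φ (Φ' x) r.domain x) ∧ Set.InjOn Φ r.domain ∧
            r'.domain = Φ '' r.domain ∧
            (∀ x ∈ r.domain, r.integrand x = r'.integrand (Φ x) * |(Φ' x).det|) ∧
            (∀ x ∈ r.domain, Φ x 0 ∈ Set.Iio (-1/2 : ℝ) ↔ x 0 ∈ Set.Iio (-1/2 : ℝ)) ∧
            x = of r - of r'} ∪
          fibredNewtonLeibnizRel) :=
  stub_ayoubBridge.symm.trans ayoubPiCancellation_iff_sideReduction_Iio

/-- **THE CRUX ⟺ SIDE REDUCTION at `S_A`**: `BetaCancellation` (stmt-13633) holds iff every relation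
among disc multiples can be re-certified without a substitution moving mass into or out of the
half-plane `{x < -1/2}` — the open core after seat c8 (weaker than wall reduction by
`wallClosure_le_sideClosure_Iio`, still ≡ item 0540). [folklore] -/
theorem betaCancellation_iff_sideReduction :
    Summit.KontsevichZagierPeriods.KontsevichZagierPeriods.Theses.TerasomaMultiplication.BetaCancellation ↔
    ∀ (P : ∀ n : ℕ, IntegralRep n → IntegralRep (n + 2)),
      (∀ (n : ℕ) (r : IntegralRep n), (P n r).domain = {z : Fin (n + 2) → ℝ | z 0 ^ 2 + z 1 ^ 2 ≤ 1 ∧ (fun i : Fin n => z i.succ.succ) ∈ r.domain} ∧ (P n r).integrand = fun z => r.integrand (fun i : Fin n => z i.succ.succ)) →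
      ∀ c : FormalRep,
        FreeAbelianGroup.lift (fun s : (Σ n, IntegralRep n) => of (P s.1 s.2)) c ∈ relations →
        FreeAbelianGroup.lift (fun s : (Σ n, IntegralRep n) => of (P s.1 s.2)) c ∈
          AddSubgroup.closure (domainAddRel ∪ integrandAddRel ∪
          {x | ∃ (n : ℕ) (r r' : IntegralRep (n + 1)) (Φ : (Fin (n + 1) → ℝ) → (Fin (n + 1) → ℝ))
              (Φ' : (Fin (n + 1) → ℝ) → (Fin (n + 1) → ℝ) →L[ℝ] (Fin (n + 1) → ℝ)),
            IsSemialgebraicMapOn ℚ r.domain Φ ∧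
            (∀ x ∈ r.domain, HasFDerivWithinAt Φ (Φ' x) r.domain x) ∧ Set.InjOn Φ r.domain ∧
            r'.domain = Φ '' r.domain ∧
            (∀ x ∈ r.domain, r.integrand x = r'.integrand (Φ x) * |(Φ' x).det|) ∧
            (∀ x ∈ r.domain, Φ x 0 ∈ Set.Iio (-1/2 : ℝ) ↔ x 0 ∈ Set.Iio (-1/2 : ℝ)) ∧
            x = of r - of r'} ∪
          fibredNewtonLeibnizRel) :=
  betaCancellation_iff_ayoubPiCancellation.trans ayoubPiCancellation_iff_sideReduction_Iio

/-- **The crux from side reduction** (closing term the day the open core lands). [folklore] -/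
theorem betaCancellation_of_sideReduction :
    (∀ (P : ∀ n : ℕ, IntegralRep n → IntegralRep (n + 2)),
      (∀ (n : ℕ) (r : IntegralRep n), (P n r).domain = {z : Fin (n + 2) → ℝ | z 0 ^ 2 + z 1 ^ 2 ≤ 1 ∧ (fun i : Fin n => z i.succ.succ) ∈ r.domain} ∧ (P n r).integrand = fun z => r.integrand (fun i : Fin n => z i.succ.succ)) →
      ∀ c : FormalRep,
        FreeAbelianGroup.lift (fun s : (Σ n, IntegralRep n) => of (P s.1 s.2)) c ∈ relations →
        FreeAbelianGroup.lift (fun s : (Σ n, IntegralRep n) => of (P s.1 s.2)) c ∈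
          AddSubgroup.closure (domainAddRel ∪ integrandAddRel ∪
          {x | ∃ (n : ℕ) (r r' : IntegralRep (n + 1)) (Φ : (Fin (n + 1) → ℝ) → (Fin (n + 1) → ℝ))
              (Φ' : (Fin (n + 1) → ℝ) → (Fin (n + 1) → ℝ) →L[ℝ] (Fin (n + 1) → ℝ)),
            IsSemialgebraicMapOn ℚ r.domain Φ ∧
            (∀ x ∈ r.domain, HasFDerivWithinAt Φ (Φ' x) r.domain x) ∧ Set.InjOn Φ r.domain ∧
            r'.domain = Φ '' r.domain ∧
            (∀ x ∈ r.domain, r.integrand x = r'.integrand (Φ x) * |(Φ' x).det|) ∧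
            (∀ x ∈ r.domain, Φ x 0 ∈ Set.Iio (-1/2 : ℝ) ↔ x 0 ∈ Set.Iio (-1/2 : ℝ)) ∧
            x = of r - of r'} ∪
          fibredNewtonLeibnizRel)) →
    Summit.KontsevichZagierPeriods.KontsevichZagierPeriods.Theses.TerasomaMultiplication.BetaCancellation :=
  fun h => betaCancellation_iff_sideReduction.2 h

/-- **Side reduction follows from wall reduction** (monotonicity of the c8 reshapes: the new open
stub is implied by the previous one). [folklore] -/
theorem sideReduction_of_wallReduction
    (h : ∀ (P : ∀ n : ℕ, IntegralRep n → IntegralRep (n + 2)),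
      (∀ (n : ℕ) (r : IntegralRep n), (P n r).domain = {z : Fin (n + 2) → ℝ | z 0 ^ 2 + z 1 ^ 2 ≤ 1 ∧ (fun i : Fin n => z i.succ.succ) ∈ r.domain} ∧ (P n r).integrand = fun z => r.integrand (fun i : Fin n => z i.succ.succ)) →
      ∀ c : FormalRep,
        FreeAbelianGroup.lift (fun s : (Σ n, IntegralRep n) => of (P s.1 s.2)) c ∈ relations →
        FreeAbelianGroup.lift (fun s : (Σ n, IntegralRep n) => of (P s.1 s.2)) c ∈
          AddSubgroup.closure (domainAddRel ∪ integrandAddRel ∪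
          {x | ∃ (n : ℕ) (r r' : IntegralRep (n + 1)) (Φ : (Fin (n + 1) → ℝ) → (Fin (n + 1) → ℝ))
              (Φ' : (Fin (n + 1) → ℝ) → (Fin (n + 1) → ℝ) →L[ℝ] (Fin (n + 1) → ℝ)),
            IsSemialgebraicMapOn ℚ r.domain Φ ∧
            (∀ x ∈ r.domain, HasFDerivWithinAt Φ (Φ' x) r.domain x) ∧ Set.InjOn Φ r.domain ∧
            r'.domain = Φ '' r.domain ∧
            (∀ x ∈ r.domain, r.integrand x = r'.integrand (Φ x) * |(Φ' x).det|) ∧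
            (∀ x ∈ r.domain, (Φ x 0 < -1/2 ↔ x 0 < -1/2) ∧ (-1/2 < Φ x 0 ↔ -1/2 < x 0)) ∧
            x = of r - of r'} ∪
          fibredNewtonLeibnizRel))
    (P : ∀ n : ℕ, IntegralRep n → IntegralRep (n + 2))
    (hP : ∀ (n : ℕ) (r : IntegralRep n), (P n r).domain = {z : Fin (n + 2) → ℝ | z 0 ^ 2 + z 1 ^ 2 ≤ 1 ∧ (fun i : Fin n => z i.succ.succ) ∈ r.domain} ∧ (P n r).integrand = fun z => r.integrand (fun i : Fin n => z i.succ.succ))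
    (c : FormalRep)
    (hc : FreeAbelianGroup.lift (fun s : (Σ n, IntegralRep n) => of (P s.1 s.2)) c ∈ relations) :
    FreeAbelianGroup.lift (fun s : (Σ n, IntegralRep n) => of (P s.1 s.2)) c ∈
          AddSubgroup.closure (domainAddRel ∪ integrandAddRel ∪
          {x | ∃ (n : ℕ) (r r' : IntegralRep (n + 1)) (Φ : (Fin (n + 1) → ℝ) → (Fin (n + 1) → ℝ))
              (Φ' : (Fin (n + 1) → ℝ) → (Fin (n + 1) → ℝ) →L[ℝ] (Fin (n + 1) → ℝ)),
            IsSemialgebraicMapOn ℚ r.domain Φ ∧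
            (∀ x ∈ r.domain, HasFDerivWithinAt Φ (Φ' x) r.domain x) ∧ Set.InjOn Φ r.domain ∧
            r'.domain = Φ '' r.domain ∧
            (∀ x ∈ r.domain, r.integrand x = r'.integrand (Φ x) * |(Φ' x).det|) ∧
            (∀ x ∈ r.domain, Φ x 0 ∈ Set.Iio (-1/2 : ℝ) ↔ x 0 ∈ Set.Iio (-1/2 : ℝ)) ∧
            x = of r - of r'} ∪
          fibredNewtonLeibnizRel) :=
  wallClosure_le_sideClosure_Iio (h P hP c hc)

end Summit.KontsevichZagierPeriods.KontsevichZagierPeriods.BetaCancellationLine
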